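import Summits.BirchSwinnertonDyer.BirchSwinnertonDyer.Theorems.ByReductionTypeAtTwoOrdKatoHalfAtTwoIsoMuFreeValueNegOfGreenbergMu
import Literature.NumberTheory.EllipticCurves.Kato2004.IwasawaH1FreeOfNoRationalTorsionProofs
import HarnessLib

/-!
# Route ByReductionTypeAtTwo, crux `OrdKatoHalfAtTwoIso` (stmt-BirchSwinnertonDyer-19573), line `steinberg-fibre-at-two`,
# F1 slot (child stmt-BirchSwinnertonDyer-24097), `Δ < 0` cell: MU13⁻ ⟺ N2D⁻ — the zeta quotient has `μ = 0` iff Kato's `2`-adic Euler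
# system is NOT `2`-divisible in `𝐇¹_Γ(T₂W)` (by Kato Thm. 12.4 (3) AT `p = 2`, now a tree theorem); hence V♭⁻ ⟺ G11⁻ ∧ N2D⁻

Seat `cruxlead-stmt-BirchSwinnertonDyer-19573-w3` g7 (prover WIDTH under the LEAD `cruxlead-19573`; HOME `run/shared/lean/pub/bsd-2adic/`;
`--supports` stmt-BirchSwinnertonDyer-24097). THEOREMS ONLY (no definition, no named fact, no `sorry`, no instance). HONEST FRAMING (cell
bsd-2adic): BSD is not proved by any of this; nothing is closed; V♭⁻ (`stub_muFreeValue_negDisc_two`, skeleton v24), G11⁻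
(`GreenbergMuZeroTwoOrdNegDisc`, published conjecture), MU13⁻ (`ZetaQuotientMuZeroTwoOrdNegDisc`) and N2D⁻ (`ZetaNotTwoDivisibleTwoOrdNegDisc`,
memo) are displayed OPEN statements; every theorem is CONDITIONAL on those it names and on the named facts `Kato2004.thm12_4` (Thm. 12.4 (2):
the RANK clause, print at every `p`), p729889 / p723619 (Poitou–Tate on Kato's carriers), p727215 (ordinary-kernel functional), PUB.

WHAT IS NEW UNDERNEATH (unconditional, w3 g7 Literature `Kato2004/IwasawaH1FreeOfNoRationalTorsionProofs`, p738189): **Kato Thm. 12.4 (3) at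
EVERY `p` for the pinned `𝐇¹_Γ(T_pW)`** — `W(ℚ)[p] = 0` (e.g. `W[p]` irreducible) ⟹ `𝐇¹_Γ(T_pW)` is Λ-FREE (regular sequence `(X, p)` on the
`Δ`-trivial component: (14.14.1) + no `p`-torsion in `H¹(Γ_ℚ, T_pW)` + the basis-lifting criterion), whereas print states 12.4 (3) for `p ≠ 2`
only. With the rank clause of 12.4 (2), `𝐇¹_Γ(T₂W) = Λ·e` on the onto cell, and then `μ(Λe ⧸ Λz) = 0 ⟺ z ∉ 2·Λe`
(`IwasawaH1Data.moduleFinite_quotient_span_iff_not_mem_smul_top`).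

* §1 `zetaQuotientMu_iff_notTwoDivisible (h12) : MU13⁻ ↔ N2D⁻`.
* §2 `muFreeValue_negDisc_iff_greenbergMuNeg_and_notTwoDivisible (hPT) (hOK) (h12) (hPub) : V♭⁻ ↔ G11⁻ ∧ N2D⁻` — the registered `Δ < 0` memo
  content of the line = Greenberg's Conjecture 1.11 at `2` on the cell (NECESSARY for the crux on the habitat) + «Kato's `2`-adic Euler system is
  not `2`-divisible in `𝐇¹_Γ(T₂W)` on the `Δ < 0` cell» (the lead's F-27a: rhombic lattice, `c_∞ = 1`), EXACTLY, modulo print;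
  `zetaColemanMuIotaNegDiscAtTwo_of_greenbergMuNeg_of_notTwoDivisible` (F1μι⁻ = conjunct 1 of child 24097 from {G11⁻, N2D⁻}).
* §3 `not_zetaNotTwoDivisible_of_twoDivisible_at`: ONE curve of the cell with all genuine classes `2`-divisible (the hypothesis `hdiv` of the
  Negative lemma p691215) refutes N2D⁻ — the disprover's currency, binder for binder.

References: [Kato2004Asterisque] Thm. 12.4 (2)(3) (p. 221), Thm. 12.6 (p. 222), §13.8 (pp. 228–229), §17.13 (pp. 279–280); [GreenbergLNM1716] Conj. 1.11
(p. 64); tree p735587/p736999, p735706/(N2D⁻ append), p736704/p737300, p738189 (+ §4 append), `…/Negative/ZetaColemanMuTwoDivisible` (p691215).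
-/

set_option autoImplicit false
set_option linter.dupNamespace false

noncomputable section

open scoped Classical MatrixGroups ModularForm NumberField
open CongruenceSubgroup WeierstrassCurve Field IsDedekindDomain NumberField
open Literature.NumberTheory.GaloisRepresentations
open Literature.NumberTheory.GaloisCohomology
open Literature.NumberTheory.EllipticCurves Literature.NumberTheory.EllipticCurves.ModularForms
  Literature.NumberTheory.EllipticCurves.GreenbergSelmer
open Literature.NumberTheory.EllipticCurves.Kato2004
  Literature.NumberTheory.EllipticCurves.Kato2004.EulerSystemValues
open Literature.NumberTheory.EllipticCurves.IwasawaDual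
open Literature.NumberTheory.EllipticCurves.Rank1Residual
open Literature.NumberTheory.EllipticCurves.Greenberg1999
open Summit.BirchSwinnertonDyer.Rank1Residual Summit.BirchSwinnertonDyer.Rank1Residual.X5
open Summit.BirchSwinnertonDyer.BirchSwinnertonDyer.Theses.ByReductionTypeAtTwo

namespace Summit.BirchSwinnertonDyer.BirchSwinnertonDyer.Theorems.SteinbergFibreAtTwo

/-! ## §1 MU13⁻ ⟺ N2D⁻ -/

/-- **MU13⁻ ⟺ N2D⁻ modulo the rank clause of Kato Thm. 12.4 (2)** (`thm12_4`): at every curve of the `Δ < 0` onto cell `W[2]` is irreducible, so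
`𝐇¹_Γ(T₂W)` is Λ-free (Kato 12.4 (3) at `2`, tree theorem) of rank `1`, `= Λ·e`, and for a class `z = β•e`: `𝐇¹_Γ ⧸ Λz ≅ Λ ⧸ (β)` is finitely
generated over `ℤ₂` iff `β ∉ (2)` iff `z ∉ 2·𝐇¹_Γ` (`IwasawaH1Data.moduleFinite_quotient_span_iff_not_mem_smul_top`). Neither side is proved;
nothing asserted. [cite: Kato2004Asterisque, Thm. 12.4 (2)(3) (p. 221), §13.8 (pp. 228–229)] -/
theorem zetaQuotientMu_iff_notTwoDivisible (h12 : thm12_4) :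
    ZetaQuotientMuZeroTwoOrdNegDisc ↔ ZetaNotTwoDivisibleTwoOrdNegDisc := by
  constructor
  · intro hZ W _ _ _ _ _ κ γ hκ hγ hΔ hord h2 hγ' I
    obtain ⟨z, hz, hfin⟩ := hZ W κ γ hκ hγ hΔ hord h2 hγ' I
    exact ⟨z, hz, (I.moduleFinite_quotient_span_iff_not_mem_smul_top h12 hκ hγ
      (hasIrreducibleModPGaloisRep_of_hasSurjectiveModNGaloisRep W 2 h2) z).mp hfin⟩
  · intro hN W _ _ _ _ _ κ γ hκ hγ hΔ hord h2 hγ' I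
    obtain ⟨z, hz, hnot⟩ := hN W κ γ hκ hγ hΔ hord h2 hγ' I
    exact ⟨z, hz, (I.moduleFinite_quotient_span_iff_not_mem_smul_top h12 hκ hγ
      (hasIrreducibleModPGaloisRep_of_hasSurjectiveModNGaloisRep W 2 h2) z).mpr hnot⟩

/-! ## §2 V♭⁻ ⟺ G11⁻ ∧ N2D⁻, and F1μι⁻ from {G11⁻, N2D⁻} -/

/-- **LOSSLESS SPLIT of the registered `Δ < 0` memo stub, divisibility currency: V♭⁻ ⟺ G11⁻ ∧ N2D⁻**, modulo the print inputs BY NAME (Poitou–Tate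
exactness p729889, the ordinary-kernel functional p727215, Kato 12.4 (2) `thm12_4`, PUB): the line's `Δ < 0` memo content is Greenberg's
Conjecture 1.11 at `2` on the cell plus «Kato's `2`-adic Euler system is not `2`-divisible in `𝐇¹_Γ(T₂W)`». Neither side is proved; nothing asserted.
[cite: Kato2004Asterisque, Thm. 12.4 (2)(3) (p. 221), §17.13 (pp. 279–280)] [cite: GreenbergLNM1716, Conj. 1.11 (p. 64)] -/
theorem muFreeValue_negDisc_iff_greenbergMuNeg_and_notTwoDivisible (hPT : exists_lambdaAdicLocalTatePairing_poitouTate_exact)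
    (hOK : exists_ordinaryKernelFunctional) (h12 : thm12_4) (hPub : OrdPublishedInputsAtTwo) :
    (∀ (W : WeierstrassCurve ℚ) [W.IsElliptic] [W.IsGloballyMinimal]
      [ContinuousSMul ℤ_[2] (W.tateModule 2)] [Module.Free ℤ_[2] (W.tateModule 2)] [Module.Finite ℤ_[2] (W.tateModule 2)]
      {N : ℕ} [NeZero N] (f : CuspForm (Gamma0 N) 2)
      (κ : ZpExtension ℚ 2) (γ : absoluteGaloisGroup ℚ) (hκ : κ.IsCyclotomic) (hγ : κ.IsTopGenerator γ),
      W.Δ < 0 → IsOrdinaryAt W 2 → W.HasSurjectiveModNGaloisRep 2 → IsCyclotomicVariable 2 γ → IsNewformOf W f →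
      ∀ (v₂ : HeightOneSpectrum (𝓞 ℚ)) (_ : ((2 : ℕ) : 𝓞 ℚ) ∈ v₂.asIdeal)
        (γᵥ : absoluteGaloisGroup (v₂.adicCompletion ℚ))
        (hsurj : Function.Surjective
          (κ.toContinuousMonoidHom.comp (resGalOfEmb (closureEmb (K := ℚ) (v₂.adicCompletion ℚ)))))
        (hγᵥ : κ.IsTopGenerator (resGalOfEmb (closureEmb (K := ℚ) (v₂.adicCompletion ℚ)) γᵥ))
        (I : IwasawaH1Data W 2 κ γ) (J : LocalIwasawaH1Data κ v₂ ((tateRep W 2).toLocal v₂) γᵥ)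
        (J' : LocalIwasawaH1Data κ v₂ (tateLocalOrdinaryRep W 2 v₂) γᵥ)
        (col : J.H →ₗ[IwasawaAlgebra 2] IwasawaAlgebra 2),
        (∀ x : J.H, col x = 0 ↔ x ∈ LinearMap.range (J'.ordinaryInclusion J)) →
        (∃ x : J.H, col x ∉ IwasawaAlgebra.augIdealP 2) →
        ∃ g : I.H, IsEulerSystemClassTwo W hκ I g ∧ col (I.loc J hsurj hγ hγᵥ g) ∉ IwasawaAlgebra.augIdealP 2) ↔
    (GreenbergMuZeroTwoOrdNegDisc ∧ ZetaNotTwoDivisibleTwoOrdNegDisc) := by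
  rw [← zetaQuotientMu_iff_notTwoDivisible h12]
  exact muFreeValue_negDisc_iff_greenbergMuNeg_and_zetaQuotientMu hPT hOK h12 hPub

/-- **F1μι⁻ = `ZetaColemanMuIotaNegDiscAtTwo` (conjunct 1 of child 24097) BY NAME from {G11⁻, N2D⁻}** over p729889, p727215, `thm12_4` and PUB.
CONDITIONAL on the displayed OPEN statements; nothing closed. [cite: Kato2004Asterisque, Thm. 12.4 (2)(3) (p. 221), Thm. 12.6 (p. 222), §17.13 (pp. 279–280)]
[cite: GreenbergLNM1716, Conj. 1.11 (p. 64)] -/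
theorem zetaColemanMuIotaNegDiscAtTwo_of_greenbergMuNeg_of_notTwoDivisible (hPT : exists_lambdaAdicLocalTatePairing_poitouTate_exact)
    (hOK : exists_ordinaryKernelFunctional) (hPub : OrdPublishedInputsAtTwo) (h12 : thm12_4)
    (hG : GreenbergMuZeroTwoOrdNegDisc) (hN : ZetaNotTwoDivisibleTwoOrdNegDisc) : ZetaColemanMuIotaNegDiscAtTwo :=
  zetaColemanMuIotaNegDiscAtTwo_of_greenbergMuNeg_of_zetaQuotientMu hPT hOK hPub hG
    ((zetaQuotientMu_iff_notTwoDivisible h12).mpr hN)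

/-! ## §3 The disprover's currency -/

/-- **One `2`-divisible curve of the `Δ < 0` cell refutes N2D⁻**: if some curve of the cell (with normalised cyclotomic data) has all genuine
`2`-adic Euler-system classes of all its pinned `𝐇¹_Γ(T₂W)` inside `(2)·𝐇¹_Γ` — the hypothesis `hdiv` of the Negative lemma
`zetaColemanMuInputsAtTwo_false_of_twoDivisible` (p691215) — then `ZetaNotTwoDivisibleTwoOrdNegDisc` is false (a pinned carrier exists,
`nonempty_iwasawaH1Data_holds`). Binder-for-binder; nothing asserted. [cite: Kato2004Asterisque, Thm. 12.6 (p. 222), §13.1 (pp. 224–225)] -/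
theorem not_zetaNotTwoDivisible_of_twoDivisible_at
    (W : WeierstrassCurve ℚ) [W.IsElliptic] [W.IsGloballyMinimal]
    [ContinuousSMul ℤ_[2] (W.tateModule 2)] [Module.Free ℤ_[2] (W.tateModule 2)] [Module.Finite ℤ_[2] (W.tateModule 2)]
    (κ : ZpExtension ℚ 2) (γ : absoluteGaloisGroup ℚ) (hκ : κ.IsCyclotomic) (hγ : κ.IsTopGenerator γ)
    (hΔ : W.Δ < 0) (hord : IsOrdinaryAt W 2) (h2 : W.HasSurjectiveModNGaloisRep 2) (hγ' : IsCyclotomicVariable 2 γ)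
    (hdiv : ∀ (I : IwasawaH1Data W 2 κ γ) (s : I.H), IsEulerSystemClassTwo W hκ I s →
      s ∈ IwasawaAlgebra.augIdealP 2 • (⊤ : Submodule (IwasawaAlgebra 2) I.H)) :
    ¬ ZetaNotTwoDivisibleTwoOrdNegDisc := by
  intro hN
  obtain ⟨I⟩ := nonempty_iwasawaH1Data_holds W 2 κ γ hκ hγ
  obtain ⟨z, hz, hnot⟩ := hN W κ γ hκ hγ hΔ hord h2 hγ' I
  exact hnot (hdiv I z hz)

end Summit.BirchSwinnertonDyer.BirchSwinnertonDyer.Theorems.SteinbergFibreAtTwo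

end
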